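import Summits.ResolutionOfSingularities.ResolutionOfSingularities.Theorems.PurelyInseparableDim4ResConeHeavyEntryFrame
import Summits.ResolutionOfSingularities.ResolutionOfSingularities.Theorems.PurelyInseparableDim4ResConeGoodInvariant
import HarnessLib
import HarnessLib.Audit.Tags

/-!
# Purely inseparable four-folds — THE ACTIVE THRESHOLD of the frozen-light two-letter game: some active letter always weighs `≥ ℓ`, and
# touching a weight-`≥ ℓ` active letter bears a weight-`≥ ℓ` newborn (`ℓ := p − d − W`; every prime `p`, every shade; ledger + TT only;
# K2(p) lane, SLICE C, the input the Φ-tracker needs on the ONE residue; file-holder res-dim4-p-5 g5)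

[OURS · counted 0 · cell `res-dim4-pi` · K2(p) lane, slice C (general-`p` programme) · seat p-5 g5.]  Nothing here proves K2(p) for any `p`,
`NoIsolatedTrap p p` or resolution of singularities in dimension ≥ 4 / characteristic `p` — NOT proved; LEDGER facts about OUR frame's
«two-letter game × frozen light monomial» (the output of `good_modulo_frozen`, taken here as HYPOTHESES `hperm`/`hgood`).
AI kernel work, weaker than expert review.

SETTING.  A constant-shade-`d` tail, a set `P` of letters permanent from `M` (weight ≥ 1, never charted, never translated — so frozen, total
`W`), and OUTSIDE `P` at every `m ≥ M` at most two boundary letters, pairwise TT.  Put `ℓ := p − d − W` (the EFFECTIVE LOSS: the newborn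
weighs `(active mass) − ℓ`).  Call a state SUB-THRESHOLD if every active letter (letter outside `P`) weighs `< ℓ`.
THE DESCENT.  From a sub-threshold state every legal step leads to a sub-threshold state of strictly smaller mass: the newborn weighs
`≤ 2(ℓ − 1) − ℓ < ℓ`, kept letters keep their weights, and the kept active mass is `< ℓ` because two TT letters are never kept together
(`not_kept_both_of_tt`).  Mass cannot descend for ever — so sub-threshold states NEVER occur from `M` on; and touching (charting or
translating) an active letter of weight `≥ ℓ` while bearing a newborn of weight `< ℓ` would create one.
* `sum_eq_of_confined₁`, `sum_eq_of_confined₂` — finite-sum bookkeeping for weights confined to one / two letters.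
* `sum_frozen_of_permanent` — the `P`-weights are frozen.
* `subThreshold_succ` — the descent step.
* **`exists_active_ge_threshold (p)`** — at every `m ≥ M` some letter outside `P` weighs `≥ ℓ`.
* **`threshold_le_newborn_of_touch (p)`** — NO FALL-OFF: at every `k ≥ M`, if a letter `h ∉ P` with `ℓ ≤ r_k h` is charted or translated,
  the newborn weighs `≥ ℓ`.  (With `P = ∅`: in the pure two-letter game a tracker sitting on letters of weight `≥ p − d` is never thrown
  onto a lighter newborn — the ledger half of «TAIL(p, d, 2) ⊆ frozen set non-empty»; with `P` all cone letters and p-11's set-criticality,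
  the same with threshold `p − d − W`.)
[cite: CossartJannsenSaito2020, Thm. 3.14, Lemma 13.2] [cite: HauserPerlega2019PRIMS, §2 (transform D′ of D)]
bears_on: LADDER-RESOLUTION:D157-DOOR2 (res-dim4-pi · K2(p) = `RidgeBudget.NoAboveFloorTrap p p` · slice C residue: active threshold / no fall-off).
Supports stmt-ResolutionOfSingularities-16155 (helper).
-/

set_option linter.dupNamespace false -- mandated namespace of this single-conjunct summit

noncomputable section

namespace Summit.ResolutionOfSingularities.ResolutionOfSingularities.Theorems.PIDim4

namespace ResCone

open MvPolynomial Finset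
open Literature.AlgebraicGeometry.Resolution
open Literature.AlgebraicGeometry.Resolution.CentreBlowup
open Literature.AlgebraicGeometry.Resolution.Hauser2010
open Literature.AlgebraicGeometry.Resolution.HauserPerlega2019

variable {K : Type} [Field K] [DecidableEq K] (p : ℕ) [Fact p.Prime]

/-- Weights confined to one letter `x` on a set `S`: the sum over `S` is `x`'s weight if `x ∈ S`, else `0`. [folklore · bookkeeping] -/
theorem sum_eq_of_confined₁ (f : Fin 4 →₀ ℕ) (S : Finset (Fin 4)) (x : Fin 4) (hz : ∀ i ∈ S, i ≠ x → f i = 0) :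
    ∑ i ∈ S, f i = if x ∈ S then f x else 0 := by
  classical
  rw [← Finset.sum_ite_eq' S x (fun i => f i)]
  refine Finset.sum_congr rfl fun i hi => ?_
  by_cases hix : i = x
  · subst hix; simp
  · rw [if_neg hix, hz i hi hix]

/-- Weights confined to two letters `x ≠ y` on a set `S`: the sum over `S` splits accordingly. [folklore · bookkeeping] -/
theorem sum_eq_of_confined₂ (f : Fin 4 →₀ ℕ) (S : Finset (Fin 4)) {x y : Fin 4} (hxy : x ≠ y)
    (hz : ∀ i ∈ S, i ≠ x → i ≠ y → f i = 0) :
    ∑ i ∈ S, f i = (if x ∈ S then f x else 0) + (if y ∈ S then f y else 0) := by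
  classical
  rw [← Finset.sum_ite_eq' S x (fun i => f i), ← Finset.sum_ite_eq' S y (fun i => f i), ← Finset.sum_add_distrib]
  refine Finset.sum_congr rfl fun i hi => ?_
  by_cases hix : i = x
  · subst hix
    rw [if_pos rfl, if_neg hxy, add_zero]
  · by_cases hiy : i = y
    · subst hiy
      rw [if_neg hix, if_pos rfl, zero_add]
    · rw [if_neg hix, if_neg hiy, hz i hi hix hiy, add_zero]

/-- **FROZEN WEIGHTS**: letters never charted nor translated from `M` on keep their weights, so their total is constant.
[OURS · bookkeeping] [cite: HauserPerlega2019PRIMS, §2 (transform D′ of D)] -/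
theorem sum_frozen_of_permanent {c : ℕ → State K} {j : ℕ → Fin 4} {b : ℕ → Fin 4 → K}
    (hc : ∀ k, IsIsolated p (c k).F ∧ Step0 p (c k) (c (k + 1))) (hw : FreeTail.IsWitnessedChain p c j b)
    (hfloor : ∀ k, ordZero (c k).F ≠ p) {M : ℕ} {P : Finset (Fin 4)}
    (hperm : ∀ z ∈ P, ∀ m, M ≤ m → z ≠ j m ∧ b m z = 0) {m : ℕ} (hm : M ≤ m) :
    ∑ z ∈ P, (c m).r z = ∑ z ∈ P, (c M).r z := by
  refine Finset.sum_congr rfl fun z hz => ?_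
  obtain ⟨t, rfl⟩ := Nat.exists_eq_add_of_le hm
  induction t with
  | zero => rfl
  | succ t ih =>
    rw [show M + (t + 1) = M + t + 1 by ring, succ_r_apply_of_ne' p hc hw hfloor (M + t) (hperm z hz _ (by omega)).1,
      if_pos (hperm z hz _ (by omega)).2]
    exact ih (by omega)

/-- **THE DESCENT STEP.**  In the frozen-light two-letter game (`P` permanent from `M`, GOOD outside `P`, `d + W + ℓ = p`), a
SUB-THRESHOLD state at `m ≥ M` (every letter outside `P` weighs `< ℓ`) is followed by a sub-threshold state of strictly smaller mass.
[OURS] [cite: CossartJannsenSaito2020, Thm. 3.14, Lemma 13.2] -/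
theorem subThreshold_succ {c : ℕ → State K} {j : ℕ → Fin 4} {b : ℕ → Fin 4 → K}
    (hc : ∀ k, IsIsolated p (c k).F ∧ Step0 p (c k) (c (k + 1))) (hw : FreeTail.IsWitnessedChain p c j b)
    (hr0 : ∀ e ∈ (c 0).F.support, (c 0).r ≤ e) (hfloor : ∀ k, ordZero (c k).F ≠ p) {k₀ d : ℕ}
    (hshade : ∀ k, k₀ ≤ k → (c k).shade = (d : ℕ∞)) {M : ℕ} (hM : k₀ ≤ M) {P : Finset (Fin 4)}
    (hperm : ∀ z ∈ P, ∀ m, M ≤ m → 1 ≤ (c m).r z ∧ z ≠ j m ∧ b m z = 0)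
    (hgood : ∀ m, M ≤ m → ((∃ x y : Fin 4, ∀ i, i ∉ P → i ≠ x → i ≠ y → (c m).r i = 0) ∧
        (∀ x y : Fin 4, x ∉ P → y ∉ P → x ≠ y → 1 ≤ (c m).r x → 1 ≤ (c m).r y →
          ∀ v ∈ resVertex (c m), v x = 0 → v y = 0 → v = 0)))
    {ℓ : ℕ} (hℓ : d + ∑ z ∈ P, (c M).r z + ℓ = p) {m : ℕ} (hm : M ≤ m) (hsub : ∀ i, i ∉ P → (c m).r i < ℓ) :
    (∀ i, i ∉ P → (c (m + 1)).r i < ℓ) ∧ (c (m + 1)).r.degree < (c m).r.degree := by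
  classical
  obtain ⟨-, hlaw, -, hband, -⟩ := tail_weights_laws hc hw hr0 hfloor hshade
  have hkm : k₀ ≤ m := by omega
  have hpm := (hband m hkm).1
  have hnew : (c (m + 1)).r (j m) + p = (c m).r.degree + d := by
    rw [hlaw m hkm, Finsupp.coe_update, Function.update_self, Nat.sub_add_cancel hpm.le]
  have hkept : ∀ i, i ≠ j m → (c (m + 1)).r i = if b m i = 0 then (c m).r i else 0 :=
    fun i hi => succ_r_apply_of_ne' p hc hw hfloor m hi
  have hperm' : ∀ z ∈ P, ∀ m, M ≤ m → z ≠ j m ∧ b m z = 0 := fun z hz m hm => (hperm z hz m hm).2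
  have hWm := sum_frozen_of_permanent p hc hw hfloor hperm' hm
  have hWm1 := sum_frozen_of_permanent p hc hw hfloor hperm' (show M ≤ m + 1 by omega)
  have hjP : j m ∉ P := fun h => (hperm _ h m hm).2.1 rfl
  obtain ⟨⟨x, y, hxy0⟩, hTT⟩ := hgood m hm
  -- mass = frozen part + active part
  have hsplit : ∀ n, (c n).r.degree = ∑ z ∈ P, (c n).r z + ∑ i ∈ Pᶜ, (c n).r i := fun n => by
    rw [Finsupp.degree_eq_sum, Finset.sum_add_sum_compl]
  -- the active mass at `m` is `< 2ℓ − 1`… precisely `≤ 2(ℓ − 1)`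
  have hact : ∑ i ∈ Pᶜ, (c m).r i + 2 ≤ 2 * ℓ := by
    have hℓ1 : 1 ≤ ℓ := by
      have := hsub (j m) hjP; omega
    by_cases hxy : x = y
    · subst hxy
      rw [sum_eq_of_confined₁ _ _ x (fun i hi hix => hxy0 i (Finset.mem_compl.1 hi) hix hix)]
      split_ifs with hx
      · have := hsub x (Finset.mem_compl.1 hx); omega
      · omega
    · rw [sum_eq_of_confined₂ _ _ hxy (fun i hi hix hiy => hxy0 i (Finset.mem_compl.1 hi) hix hiy)]
      have h1 : (if x ∈ Pᶜ then (c m).r x else 0) + 1 ≤ ℓ := by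
        split_ifs with hx
        · have := hsub x (Finset.mem_compl.1 hx); omega
        · omega
      have h2 : (if y ∈ Pᶜ then (c m).r y else 0) + 1 ≤ ℓ := by
        split_ifs with hy
        · have := hsub y (Finset.mem_compl.1 hy); omega
        · omega
      omega
  -- hence the newborn weighs `< ℓ`
  have hnb : (c (m + 1)).r (j m) + 2 ≤ ℓ := by
    have := hsplit m; omega
  refine ⟨fun i hiP => ?_, ?_⟩
  · by_cases hij : i = j m
    · rw [hij]; omega
    · rw [hkept i hij]
      split_ifs
      · exact hsub i hiP
      · exact lt_of_le_of_lt (Nat.zero_le _) (by have := hsub i hiP; omega)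
  · -- the new mass: frozen part + newborn + kept active letters, the latter `< ℓ`
    have hS : ∑ i ∈ Pᶜ, (c (m + 1)).r i = (c (m + 1)).r (j m) + ∑ i ∈ Pᶜ.erase (j m), (c (m + 1)).r i :=
      (Finset.add_sum_erase _ _ (Finset.mem_compl.2 hjP)).symm
    have hK : ∑ i ∈ Pᶜ.erase (j m), (c (m + 1)).r i + 1 ≤ ℓ := by
      have hz : ∀ i ∈ Pᶜ.erase (j m), i ≠ x → i ≠ y → (c (m + 1)).r i = 0 := by
        intro i hi hix hiy
        obtain ⟨hij, hiP⟩ := Finset.mem_erase.1 hi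
        rw [hkept i hij, hxy0 i (Finset.mem_compl.1 hiP) hix hiy, ite_self]
      -- value of a kept active letter
      have hval : ∀ i ∈ Pᶜ.erase (j m), (c (m + 1)).r i + 1 ≤ ℓ ∧
          (1 ≤ (c (m + 1)).r i → b m i = 0 ∧ 1 ≤ (c m).r i) := by
        intro i hi
        obtain ⟨hij, hiP⟩ := Finset.mem_erase.1 hi
        have hiP' := Finset.mem_compl.1 hiP
        rw [hkept i hij]
        by_cases hb : b m i = 0
        · rw [if_pos hb]; exact ⟨hsub i hiP', fun h => ⟨hb, h⟩⟩
        · rw [if_neg hb]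
          exact ⟨by have := hsub i hiP'; omega, fun h => absurd h (by omega)⟩
      by_cases hxy : x = y
      · subst hxy
        rw [sum_eq_of_confined₁ _ _ x (fun i hi hix => hz i hi hix hix)]
        split_ifs with hx
        · exact (hval x hx).1
        · have := hsub (j m) hjP; omega
      · rw [sum_eq_of_confined₂ _ _ hxy hz]
        by_cases hx : x ∈ Pᶜ.erase (j m)
        · by_cases hy : y ∈ Pᶜ.erase (j m)
          · rw [if_pos hx, if_pos hy]
            -- not both kept with positive weight: TT
            by_cases hx1 : 1 ≤ (c (m + 1)).r x
            · by_cases hy1 : 1 ≤ (c (m + 1)).r y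
              · exfalso
                obtain ⟨hbx, hx0⟩ := (hval x hx).2 hx1
                obtain ⟨hby, hy0⟩ := (hval y hy).2 hy1
                exact not_kept_both_of_tt p hc hw hr0 hfloor hshade hkm
                  (hTT x y (Finset.mem_compl.1 (Finset.mem_erase.1 hx).2) (Finset.mem_compl.1 (Finset.mem_erase.1 hy).2)
                    hxy hx0 hy0) (Finset.mem_erase.1 hx).1 hbx (Finset.mem_erase.1 hy).1 hby
              · have := (hval x hx).1; omega
            · have := (hval y hy).1; omega
          · rw [if_pos hx, if_neg hy, add_zero]; exact (hval x hx).1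
        · by_cases hy : y ∈ Pᶜ.erase (j m)
          · rw [if_neg hx, if_pos hy, zero_add]; exact (hval y hy).1
          · rw [if_neg hx, if_neg hy]; have := hsub (j m) hjP; omega
    have h0 := hsplit m
    have h1 := hsplit (m + 1)
    omega

/-- **THE ACTIVE THRESHOLD PERSISTS** (every prime `p`, every shade; ledger + TT): in the frozen-light two-letter game — `P` permanent
from `M ≥ k₀` with weights `≥ 1`, GOOD outside `P` from `M`, and `d + Σ_{z ∈ P} r_M z + ℓ = p` — at every `m ≥ M` some letter outside
`P` weighs at least `ℓ`. [OURS] [cite: CossartJannsenSaito2020, Thm. 3.14, Lemma 13.2] -/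
theorem exists_active_ge_threshold {c : ℕ → State K} {j : ℕ → Fin 4} {b : ℕ → Fin 4 → K}
    (hc : ∀ k, IsIsolated p (c k).F ∧ Step0 p (c k) (c (k + 1))) (hw : FreeTail.IsWitnessedChain p c j b)
    (hr0 : ∀ e ∈ (c 0).F.support, (c 0).r ≤ e) (hfloor : ∀ k, ordZero (c k).F ≠ p) {k₀ d : ℕ}
    (hshade : ∀ k, k₀ ≤ k → (c k).shade = (d : ℕ∞)) {M : ℕ} (hM : k₀ ≤ M) {P : Finset (Fin 4)}
    (hperm : ∀ z ∈ P, ∀ m, M ≤ m → 1 ≤ (c m).r z ∧ z ≠ j m ∧ b m z = 0)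
    (hgood : ∀ m, M ≤ m → ((∃ x y : Fin 4, ∀ i, i ∉ P → i ≠ x → i ≠ y → (c m).r i = 0) ∧
        (∀ x y : Fin 4, x ∉ P → y ∉ P → x ≠ y → 1 ≤ (c m).r x → 1 ≤ (c m).r y →
          ∀ v ∈ resVertex (c m), v x = 0 → v y = 0 → v = 0)))
    {ℓ : ℕ} (hℓ : d + ∑ z ∈ P, (c M).r z + ℓ = p) {m : ℕ} (hm : M ≤ m) : ∃ i, i ∉ P ∧ ℓ ≤ (c m).r i := by
  by_contra hno
  push Not at hno
  -- descent for ever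
  have hdesc : ∀ n, (∀ i, i ∉ P → (c (m + n)).r i < ℓ) ∧ (c (m + n)).r.degree + n ≤ (c m).r.degree := by
    intro n
    induction n with
    | zero => exact ⟨fun i hi => hno i hi, by simp⟩
    | succ n ih =>
      have h := subThreshold_succ p hc hw hr0 hfloor hshade hM hperm hgood hℓ (show M ≤ m + n by omega) ih.1
      rw [show m + (n + 1) = m + n + 1 by ring]
      exact ⟨h.1, by have := h.2; have := ih.2; omega⟩
  have := (hdesc ((c m).r.degree + 1)).2
  omega

/-- **NO FALL-OFF** (every prime `p`, every shade; ledger + TT): in the frozen-light two-letter game as above, at every step `k ≥ M` that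
CHARTS or TRANSLATES a letter `h ∉ P` of weight `≥ ℓ`, the newborn weighs `≥ ℓ` as well.  (With `P = ∅`, `ℓ = p − d`: a Φ-tracker
sitting on letters of weight `≥ p − d` is only ever thrown onto newborns of weight `≥ p − d`.) [OURS]
[cite: CossartJannsenSaito2020, Thm. 3.14, Lemma 13.2] -/
theorem threshold_le_newborn_of_touch {c : ℕ → State K} {j : ℕ → Fin 4} {b : ℕ → Fin 4 → K}
    (hc : ∀ k, IsIsolated p (c k).F ∧ Step0 p (c k) (c (k + 1))) (hw : FreeTail.IsWitnessedChain p c j b)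
    (hr0 : ∀ e ∈ (c 0).F.support, (c 0).r ≤ e) (hfloor : ∀ k, ordZero (c k).F ≠ p) {k₀ d : ℕ}
    (hshade : ∀ k, k₀ ≤ k → (c k).shade = (d : ℕ∞)) {M : ℕ} (hM : k₀ ≤ M) {P : Finset (Fin 4)}
    (hperm : ∀ z ∈ P, ∀ m, M ≤ m → 1 ≤ (c m).r z ∧ z ≠ j m ∧ b m z = 0)
    (hgood : ∀ m, M ≤ m → ((∃ x y : Fin 4, ∀ i, i ∉ P → i ≠ x → i ≠ y → (c m).r i = 0) ∧
        (∀ x y : Fin 4, x ∉ P → y ∉ P → x ≠ y → 1 ≤ (c m).r x → 1 ≤ (c m).r y →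
          ∀ v ∈ resVertex (c m), v x = 0 → v y = 0 → v = 0)))
    {ℓ : ℕ} (hℓ : d + ∑ z ∈ P, (c M).r z + ℓ = p) {k : ℕ} (hk : M ≤ k) {h : Fin 4} (hhP : h ∉ P) (hh : ℓ ≤ (c k).r h)
    (htouch : j k = h ∨ b k h ≠ 0) : ℓ ≤ (c (k + 1)).r (j k) := by
  classical
  by_contra hlt
  push Not at hlt
  obtain ⟨-, hlaw, -, hband, -⟩ := tail_weights_laws hc hw hr0 hfloor hshade
  have hkk : k₀ ≤ k := by omega
  have hpk := (hband k hkk).1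
  have hnew : (c (k + 1)).r (j k) + p = (c k).r.degree + d := by
    rw [hlaw k hkk, Finsupp.coe_update, Function.update_self, Nat.sub_add_cancel hpk.le]
  have hkept : ∀ i, i ≠ j k → (c (k + 1)).r i = if b k i = 0 then (c k).r i else 0 :=
    fun i hi => succ_r_apply_of_ne' p hc hw hfloor k hi
  have hperm' : ∀ z ∈ P, ∀ m, M ≤ m → z ≠ j m ∧ b m z = 0 := fun z hz m hm => (hperm z hz m hm).2
  have hWk := sum_frozen_of_permanent p hc hw hfloor hperm' hk
  have hsplit : (c k).r.degree = ∑ z ∈ P, (c k).r z + ∑ i ∈ Pᶜ, (c k).r i := by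
    rw [Finsupp.degree_eq_sum, Finset.sum_add_sum_compl]
  -- every OTHER active letter weighs `< ℓ`: two active letters `h, i` weigh at most the active mass `< 2ℓ`
  have hother : ∀ i, i ∉ P → i ≠ h → (c k).r i < ℓ := by
    intro i hiP hih
    have hsub2 : ∑ i ∈ ({h, i} : Finset (Fin 4)), (c k).r i ≤ ∑ i ∈ Pᶜ, (c k).r i :=
      Finset.sum_le_sum_of_subset_of_nonneg
        (fun a ha => by
          rcases Finset.mem_insert.1 ha with rfl | ha
          · exact Finset.mem_compl.2 hhP
          · rw [Finset.mem_singleton.1 ha]; exact Finset.mem_compl.2 hiP)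
        fun _ _ _ => Nat.zero_le _
    rw [Finset.sum_pair (Ne.symm hih)] at hsub2
    omega
  -- so the child is sub-threshold: contradiction with the persistence of the threshold
  obtain ⟨i, hiP, hi⟩ := exists_active_ge_threshold p hc hw hr0 hfloor hshade hM hperm hgood hℓ (show M ≤ k + 1 by omega)
  by_cases hij : i = j k
  · rw [hij] at hi; omega
  · rw [hkept i hij] at hi
    by_cases hih : i = h
    · subst hih
      rcases htouch with hjk | hb
      · exact hij hjk.symm
      · rw [if_neg hb] at hi; omega
    · have := hother i hiP hih
      split_ifs at hi <;> omega

end ResCone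

end Summit.ResolutionOfSingularities.ResolutionOfSingularities.Theorems.PIDim4

end
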